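/-
Copyright (c) 2026. All rights reserved.
Released under Apache 2.0 license as described in the file LICENSE.
-/
import Summits.Langlands.Langlands.Theorems.SoloInformedGLOneR3plus
import Literature.NumberTheory.PAdicHodge.DeRhamInducedRepresentationWeightsProofs
import Literature.NumberTheory.GaloisRepresentations.AlgebraicHeckeCharacterPurity
import Literature.NumberTheory.Automorphic.GLOneArchParameterOfAlgebraicCharacter
import Mathlib.NumberTheory.NumberField.InfinitePlace.TotallyRealComplex
import HarnessLib

/-!
# The Hodge–Tate third of the repaired `n = 1` conjunct is a theorem for parallel infinity types —
# the R3⁺-repaired summit holds for `GL₁` over every totally real field granting two named facts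

File Λ24 of the programme `solo-Langlands-informed`; sequel of Λ23 (`SoloInformedGLOneR3plus`).
There, granting the two facts the tree keeps as named hypotheses
(dR₁ = `HeckeCharacter.exists_lAdic_isDeRhamFramed`, Serre III §2.3 + App. A / Conrad App. B.4;
FM₁ = `FramedGaloisRep.exists_heckeCharacter_of_isDeRhamFramed`, Patrikis Prop. 2.2.1), the
R3⁺-repaired `n = 1` conjunct `R3plus.GlobalLanglandsCorrespondenceGLnR3plus 1 K 𝓡 hcpt` was shown
EQUIVALENT to the ε-free statement HT₁: for every cuspidal `π` of `GL₁/K` with Hecke character `θ` of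
infinity type `(p, q)`, the `τ`-labelled Hodge–Tate weights of Weil's character `r_{θ,ι}|Γ_{K_v}` at
every `v ∣ ℓ` are `{n_{ι∘τ}(θ)}` (Buzzard–Gee Rem. 3.2.3, convention `HT(ε_ℓ) = -1` on both sides).

Here HT₁ is PROVED, unconditionally and for THE pinned Fontaine datum, for every `θ` whose embedding
exponents are PARALLEL (`n_φ(θ) = n₀` for all `φ : K → ℂ`):

* §1 `labelledHodgeTateWeightsAt_eq_singleton_of_embExponent_eq`: a continuous
  `ρ : Γ_K → GL₁(ℚ̄_ℓ)` with Weil's Frobenius dictionary `ρ(Frob_w) = ι⁻¹(θ(ϖ_w))⁻¹` a.e. for such a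
  `θ` has `HT_τ(ρ|Γ_{K_v}) = {n₀}` at every `v ∣ ℓ` and every continuous label `τ`.  Road (all of it
  accepted tree theorems): `ρ ⊗ ε_ℓ^{n₀}` has finite image (Weil 1956: a parallel type is a norm power
  up to finite order; Frobenius rigidity along a density-one set —
  `FramedGaloisRep.finite_range_twist_of_hasFrobCharpolyAt_of_embExponent_eq`); Tate twists shift the
  labelled weights of the pinned datum (`labelledHodgeTateWeightsAt_twist_of_cyclotomic_zpow`);
  finite-image representations have labelled weights `0`
  (`labelledHodgeTateWeightsAt_eq_replicate_zero_of_finite_range`).  This is the rank-one,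
  trivial-induction case of the tree's `labelledHodgeTateWeightsAt_induce_eq_replicate_of_embExponent_eq`.
* §2 `hodgeTateCompatibleAt_of_embExponent_eq`, `hodgeTateCompatibleAt_weilRep_of_embExponent_eq`:
  hence `(π, ρ)` — in particular `(π, r_{θ,ι})` — is Hodge–Tate compatible at every `v ∣ ℓ` in the
  sense of `R3plus.HodgeTateCompatibleAt`; the kernel thereby certifies that the two sign conventions of
  `SoloInformedRepairR3plus` (Galois side: `HT(ε_ℓ) = -1`; automorphic side: weight `(a, b)` contributes
  `-a`, Clozel's parameter `a = -n_φ`) AGREE on `GL₁`.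
* §3 `exists_embExponent_eq_of_isTotallyReal`: over a totally real `K` every algebraic infinity type
  is parallel (purity `n_φ + n_{φ̄} = w`, `HasInfinityType.exists_embExponent_add_conjugate_eq`,
  Patrikis Lemma 2.1.3, and `φ̄ = φ`); the pairwise form `n_φ = n_{φ'}` is already a theorem of the
  tree (`DyadicEisensteinFM.embExponent_eq_of_isTotallyReal`, cited, not imported).
* §4 ★ `globalLanglandsCorrespondenceGLnR3plus_one_iff_ht_nonparallel_of_facts`: granting dR₁ and
  FM₁, the repaired `n = 1` conjunct over ANY `K` ⟺ HT₁ for the NON-parallel `θ` only (these exist iff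
  `K` contains a CM field, Weil 1956);  ★★ `automorphicToGaloisR3plus_one_of_fact_of_isTotallyReal`:
  over a totally real `K`, clause (A⁺)₁ holds granting dR₁ ALONE;
  ★★★ `globalLanglandsCorrespondenceGLnR3plus_one_of_facts_of_isTotallyReal`: over a totally real `K`
  the R3⁺-repaired summit HOLDS for `n = 1` granting dR₁ and FM₁ — two theorems in print about
  constructed objects — for every reciprocity datum `𝓡`.  Λ23 needed HT₁ as a third hypothesis.

What remains of HT₁ in general (`K ⊇` a CM field, `θ` of non-parallel type, e.g. the Hecke character
of a CM elliptic curve): `HT_τ(r_{θ,ι}|Γ_{K_v}) = {n_{ι∘τ}}` with the weights now depending on the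
label — Serre's theorem that a locally algebraic abelian representation is Hodge–Tate of the type read
off its algebraic part (Serre III §1.1 + App. A.5), whose proof needs the periods of Lubin–Tate
characters in `B_dR` (Colmez), not in the tree.  No definitions, no new hypotheses.

Citations: [SerreAbelianLadic1968] III §1.1, §2.3, §3, App. A.5; [Patrikis2019] Lemma 2.1.3,
Cor. 2.2.3, Lemma 2.2.4, Prop. 2.2.1; [Weil1956] §§1–2; [BuzzardGeeLMS2014] Conj. 3.2.1–3.2.2,
Rem. 3.2.3; [FontaineAsterisque223III] Exp. III §1.5; [Clozel1990] §3.3; [Conrad2011LiftingGlobal]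
App. B Prop. B.4.
-/

noncomputable section
open scoped MatrixGroups Matrix Classical Polynomial NumberField
open NumberField IsDedekindDomain Field Polynomial Filter
open Literature.NumberTheory.Automorphic Literature.NumberTheory.GaloisRepresentations
open Literature.NumberTheory.PAdicHodge

namespace Summit.Langlands.Langlands.Theorems

namespace GLOneRigidity

section HodgeTateParallel

variable {K : Type} [Field K] [NumberField K] {hcpt : isCompact_glFiniteIntegralLevel 1 K}
  {ℓ : ℕ} [Fact ℓ.Prime] {θ : HeckeCharacter K} {p q : InfinitePlace K → ℤ}
  {T : Finset (HeightOneSpectrum (𝓞 K))} {e : HeightOneSpectrum (𝓞 K) → ℕ}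

/-! ### §1 Labelled Hodge–Tate weights of a character of parallel type -/

/-- **A character with Weil's Frobenius dictionary for a Hecke character of parallel type `n₀` has
all labelled Hodge–Tate weights `n₀` above `ℓ`** (for THE pinned datum `fontainePstAdicCompletion`):
if `ρ : Γ_K → GL₁(ℚ̄_ℓ)` is continuous with `ρ(Frob_w^{arith}) = ι⁻¹(θ(ϖ_w))⁻¹` at almost all `w`, `θ`
of infinity type `(p, q)` with `n_φ = n₀` for every `φ : K → ℂ`, then
`HT_τ(ρ|Γ_{K_v}) = {n₀}` at every `v ∣ ℓ` and every continuous `τ : K_v → ℚ̄_ℓ`.  Proof: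
`ρ ⊗ ε_ℓ^{n₀}` has finite image (Weil: `θ‖·‖^{n₀}` has finite order; Frobenius rigidity), so its
labelled weights vanish, and `ρ = (ρ ⊗ ε_ℓ^{n₀}) ⊗ ε_ℓ^{-n₀}` shifts them by `n₀` (`HT(ε_ℓ) = -1`).
[cite: SerreAbelianLadic1968, Ch. III §1.1, §2.3 and App. A.5] [cite: Patrikis2019, Cor. 2.2.3 (proof) and Lemma 2.2.4]
[cite: FontaineAsterisque223III, Exp. III §1.5] -/
theorem labelledHodgeTateWeightsAt_eq_singleton_of_embExponent_eq
    (ρ : FramedGaloisRep K (PadicAlgCl ℓ) 1) (ι : PadicAlgCl ℓ ≃+* ℂ) (hinf : θ.HasInfinityType p q)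
    (hρ : ∀ᶠ w : HeightOneSpectrum (𝓞 K) in cofinite,
      ρ.HasFrobCharpolyAt w (X - C (ι.symm (θ.valueAtUniformizer w)⁻¹)))
    {n₀ : ℤ} (hn : ∀ φ : K →+* ℂ, HeckeCharacter.embExponent p q φ = n₀)
    (v : HeightOneSpectrum (𝓞 K)) (hv : ((ℓ : ℕ) : 𝓞 K) ∈ v.asIdeal)
    (τ : v.adicCompletion K →+* PadicAlgCl ℓ) (hτ : Continuous τ) :
    ρ.labelledHodgeTateWeightsAt v (fontainePstAdicCompletion v ℓ hv).algebra
      (fontainePstAdicCompletion v ℓ hv).𝔅 τ = {n₀} := by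
  haveI : NeZero (ℓ : K) := ⟨Nat.cast_ne_zero.mpr (Fact.out : ℓ.Prime).ne_zero⟩
  -- `ε = ε_ℓ^{n₀} : Γ_K →ₜ* ℚ̄_ℓˣ`
  obtain ⟨ε, hε⟩ := exists_cyclotomicCharacter_padicAlgCl_zpow K ℓ n₀
  -- `ρ ⊗ ε` has finite image (Weil + Frobenius rigidity), hence finite local image at `v`
  have hfin : (Set.range (FramedRep.twist ρ ε)).Finite :=
    FramedGaloisRep.finite_range_twist_of_hasFrobCharpolyAt_of_embExponent_eq ρ ι θ p q hinf hρ hn ε hε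
  have hloc : (Set.range (FramedGaloisRep.toLocal v (FramedRep.twist ρ ε))).Finite := by
    refine hfin.subset ?_
    rintro _ ⟨σ, rfl⟩
    exact ⟨absGaloisRestrict K (v.adicCompletion K) σ, rfl⟩
  -- `ε⁻¹ ∘ res_v = ε_ℓ^{-n₀}` on `Γ_{K_v}`
  have hε' : ∀ σ : absoluteGaloisGroup (v.adicCompletion K),
      ((ε⁻¹ : absoluteGaloisGroup K →ₜ* (PadicAlgCl ℓ)ˣ) (absGaloisRestrict K (v.adicCompletion K) σ) :
          PadicAlgCl ℓ) =
        (algebraMap ℚ_[ℓ] (PadicAlgCl ℓ)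
          ((GaloisRep.cyclotomicCharacter (v.adicCompletion K) ℓ σ : ℤ_[ℓ]ˣ) : ℤ_[ℓ])) ^ (-n₀) :=
    fun σ => by
      show (((ε (absGaloisRestrict K (v.adicCompletion K) σ))⁻¹ : (PadicAlgCl ℓ)ˣ) : PadicAlgCl ℓ) = _
      rw [Units.val_inv_eq_inv_val, hε, cyclotomicCharacter_absGaloisRestrict K (v.adicCompletion K) ℓ σ,
        zpow_neg]
  -- `ρ = (ρ ⊗ ε) ⊗ ε⁻¹`: the weights of `ρ ⊗ ε` are `{0}`, shifted by `-(-n₀)`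
  have hρ' : ρ = FramedRep.twist (FramedRep.twist ρ ε) ε⁻¹ := (FramedRep.twist_twist_inv ρ ε).symm
  rw [hρ', FramedGaloisRep.labelledHodgeTateWeightsAt_twist_of_cyclotomic_zpow _ ε⁻¹ (-n₀) v hv hε' τ,
    FramedGaloisRep.labelledHodgeTateWeightsAt_eq_replicate_zero_of_finite_range _ v hv hloc τ hτ,
    Multiset.map_replicate, zero_sub, neg_neg, Multiset.replicate_one]

/-- Weil's character `r_{θ,ι}` has Weil's Frobenius dictionary at almost all places (all `w ∉ T`,
`w ∤ ℓ`). [cite: Weil1956, §2] -/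
theorem eventually_hasFrobCharpolyAt_weilRep (ι : PadicAlgCl ℓ ≃+* ℂ) (hinf : θ.HasInfinityType p q)
    (hmod : HeckeCharacter.IsModulus θ T e) :
    ∀ᶠ w : HeightOneSpectrum (𝓞 K) in cofinite,
      (hinf.weilRep hmod ι).HasFrobCharpolyAt w (X - C (ι.symm (θ.valueAtUniformizer w)⁻¹)) := by
  have hℓ : ∀ᶠ w : HeightOneSpectrum (𝓞 K) in cofinite, ((ℓ : ℕ) : 𝓞 K) ∉ w.asIdeal :=
    Literature.RingTheory.DedekindDomain.eventually_not_mem_asIdeal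
      (Nat.cast_ne_zero.mpr (Fact.out : ℓ.Prime).ne_zero)
  filter_upwards [T.eventually_cofinite_notMem, hℓ] with w hwT hwℓ
  exact hinf.hasFrobCharpolyAt_weilRep hmod ι hwT hwℓ

/-- **The labelled Hodge–Tate weights of `r_{θ,ι}` for `θ` of parallel type `n₀` are `{n₀}`** at
every `v ∣ ℓ` and every continuous label. [cite: SerreAbelianLadic1968, Ch. III §1.1 and §2.3]
[cite: Patrikis2019, Cor. 2.2.3 (proof) and Lemma 2.2.4] -/
theorem labelledHodgeTateWeightsAt_weilRep_of_embExponent_eq (ι : PadicAlgCl ℓ ≃+* ℂ)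
    (hinf : θ.HasInfinityType p q) (hmod : HeckeCharacter.IsModulus θ T e)
    {n₀ : ℤ} (hn : ∀ φ : K →+* ℂ, HeckeCharacter.embExponent p q φ = n₀)
    (v : HeightOneSpectrum (𝓞 K)) (hv : ((ℓ : ℕ) : 𝓞 K) ∈ v.asIdeal)
    (τ : v.adicCompletion K →+* PadicAlgCl ℓ) (hτ : Continuous τ) :
    (hinf.weilRep hmod ι).labelledHodgeTateWeightsAt v (fontainePstAdicCompletion v ℓ hv).algebra
      (fontainePstAdicCompletion v ℓ hv).𝔅 τ = {n₀} :=
  labelledHodgeTateWeightsAt_eq_singleton_of_embExponent_eq _ ι hinf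
    (eventually_hasFrobCharpolyAt_weilRep ι hinf hmod) hn v hv τ hτ

/-! ### §2 Hodge–Tate compatibility for parallel types -/

/-- **Hodge–Tate compatibility (R3⁺) holds on `GL₁` for parallel types**: if the ideles act on the
automorphic `π` of `GL₁/K` through `θ ∘ det`, `θ` of infinity type `(p, q)` with all `n_φ = n₀`, and
`ρ : Γ_K → GL₁(ℚ̄_ℓ)` carries Weil's Frobenius dictionary for `θ` a.e., then `(π, ρ)` is Hodge–Tate
compatible at every `v ∣ ℓ`: both sides of Buzzard–Gee's recipe equal `{n₀}` — the Galois side by §1,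
the automorphic side because `π_∞` has Clozel's parameter `a_φ = -n_φ`
(`exists_hasInfinityType_of_hasInfinityType_heckeCharacter_glOne`) and the recipe reads `-a_φ`.
The kernel thereby checks that the two sign conventions of `SoloInformedRepairR3plus` agree.
[cite: BuzzardGeeLMS2014, Conj. 3.2.2 and Rem. 3.2.3] [cite: Clozel1990, §3.3]
[cite: SerreAbelianLadic1968, Ch. III §1.1] -/
theorem hodgeTateCompatibleAt_of_embExponent_eq (𝓡 : ReciprocityData K) (ι : PadicAlgCl ℓ ≃+* ℂ)
    (π : AutomorphicRepData (AutomorphyDatum.gl 1 K hcpt))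
    (hχ : ∀ (g : (AdelicGroupData.gl 1 K).Adelic), ∀ φ ∈ π.W,
      rightTranslation (AdelicGroupData.gl 1 K) g φ -
        ((θ (Matrix.GeneralLinearGroup.det g) : ℂˣ) : ℂ) • φ ∈ π.W')
    (hinf : θ.HasInfinityType p q) {n₀ : ℤ} (hn : ∀ φ : K →+* ℂ, HeckeCharacter.embExponent p q φ = n₀)
    (ρ : FramedGaloisRep K (PadicAlgCl ℓ) 1)
    (hρ : ∀ᶠ w : HeightOneSpectrum (𝓞 K) in cofinite,
      ρ.HasFrobCharpolyAt w (X - C (ι.symm (θ.valueAtUniformizer w)⁻¹)))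
    (v : HeightOneSpectrum (𝓞 K)) (hv : ((ℓ : ℕ) : 𝓞 K) ∈ v.asIdeal) :
    R3plus.HodgeTateCompatibleAt 𝓡 ι π ρ v hv := by
  obtain ⟨T₀, hT₀, hTa⟩ := π.exists_hasInfinityType_of_hasInfinityType_heckeCharacter_glOne hχ hinf
  rw [R3plus.hodgeTateCompatibleAt_iff_of_hasInfinityType hT₀]
  intro τ hτ
  have hW : ρ.labelledHodgeTateWeightsAt v (𝓡.pst ℓ v hv).algebra (𝓡.pst ℓ v hv).𝔅 τ = {n₀} :=
    labelledHodgeTateWeightsAt_eq_singleton_of_embExponent_eq ρ ι hinf hρ hn v hv τ hτ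
  have hneg : ∀ s : Multiset ArchWeight,
      s.map (fun w : ArchWeight => -w.a) = (s.map ArchWeight.a).map Neg.neg := fun s => by
    rw [Multiset.map_map]; rfl
  rw [hW, InfinityType.hodgeTateWeights, hneg, hTa, hn]
  simp only [Multiset.map_singleton, neg_neg]

/-- **`(π, r_{θ,ι})` is Hodge–Tate compatible at every `v ∣ ℓ` when `θ` has parallel type.**
[cite: BuzzardGeeLMS2014, Rem. 3.2.3] [cite: SerreAbelianLadic1968, Ch. III §1.1 and §2.3] -/
theorem hodgeTateCompatibleAt_weilRep_of_embExponent_eq (𝓡 : ReciprocityData K)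
    (ι : PadicAlgCl ℓ ≃+* ℂ) (π : AutomorphicRepData (AutomorphyDatum.gl 1 K hcpt))
    (hχ : ∀ (g : (AdelicGroupData.gl 1 K).Adelic), ∀ φ ∈ π.W,
      rightTranslation (AdelicGroupData.gl 1 K) g φ -
        ((θ (Matrix.GeneralLinearGroup.det g) : ℂˣ) : ℂ) • φ ∈ π.W')
    (hinf : θ.HasInfinityType p q) (hmod : HeckeCharacter.IsModulus θ T e)
    {n₀ : ℤ} (hn : ∀ φ : K →+* ℂ, HeckeCharacter.embExponent p q φ = n₀)
    (v : HeightOneSpectrum (𝓞 K)) (hv : ((ℓ : ℕ) : 𝓞 K) ∈ v.asIdeal) :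
    R3plus.HodgeTateCompatibleAt 𝓡 ι π (hinf.weilRep hmod ι) v hv :=
  hodgeTateCompatibleAt_of_embExponent_eq 𝓡 ι π hχ hinf hn _
    (eventually_hasFrobCharpolyAt_weilRep ι hinf hmod) v hv

/-- Hence, for `θ` of parallel type, `ρ` R3⁺-corresponds to `π` iff `ρ = r_{θ,ι}`: the Hodge–Tate
clause of Λ23 `correspondsR3plus_iff_eq_weilRep` is automatic.
[cite: BuzzardGeeLMS2014, Conj. 3.2.1–3.2.2 and Rem. 3.2.3] -/
theorem correspondsR3plus_iff_eq_weilRep_of_embExponent_eq (𝓡 : ReciprocityData K)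
    (ι : PadicAlgCl ℓ ≃+* ℂ) (π : AutomorphicRepData (AutomorphyDatum.gl 1 K hcpt))
    (hχ : ∀ (g : (AdelicGroupData.gl 1 K).Adelic), ∀ φ ∈ π.W,
      rightTranslation (AdelicGroupData.gl 1 K) g φ -
        ((θ (Matrix.GeneralLinearGroup.det g) : ℂˣ) : ℂ) • φ ∈ π.W')
    (hinf : θ.HasInfinityType p q) (hmod : HeckeCharacter.IsModulus θ T e)
    {n₀ : ℤ} (hn : ∀ φ : K →+* ℂ, HeckeCharacter.embExponent p q φ = n₀)
    (ρ : FramedGaloisRep K (PadicAlgCl ℓ) 1) :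
    R3plus.CorrespondsR3plus 𝓡 ι π ρ ↔ ρ = hinf.weilRep hmod ι := by
  rw [correspondsR3plus_iff_eq_weilRep 𝓡 ι π hχ hinf hmod ρ]
  refine ⟨fun h => h.1, fun h => ⟨h, ?_⟩⟩
  subst h
  exact fun v hv => hodgeTateCompatibleAt_weilRep_of_embExponent_eq 𝓡 ι π hχ hinf hmod hn v hv

/-! ### §3 Totally real fields: every algebraic infinity type is parallel -/

/-- **Over a totally real field every algebraic infinity type is parallel**: there is `n₀` with
`n_φ = n₀` for every `φ : K → ℂ` — purity gives `w` with `n_φ + n_{φ̄} = w`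
(`HasInfinityType.exists_embExponent_add_conjugate_eq`, Patrikis Lemma 2.1.3 / Weil 1956) and
`φ̄ = φ` (Mathlib `IsTotallyReal.complexEmbedding_isReal`).  (Pairwise form `n_φ = n_{φ'}`: the tree's
`DyadicEisensteinFM.embExponent_eq_of_isTotallyReal`, cited, not imported.)
[cite: Patrikis2019, Lemma 2.1.3 (arXiv:1207.6724 §2.1)] [cite: Weil1956, §1] -/
theorem exists_embExponent_eq_of_isTotallyReal [IsTotallyReal K] (hinf : θ.HasInfinityType p q) :
    ∃ n₀ : ℤ, ∀ φ : K →+* ℂ, HeckeCharacter.embExponent p q φ = n₀ := by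
  obtain ⟨wt, hwt⟩ := hinf.exists_embExponent_add_conjugate_eq
  obtain ⟨φ₀⟩ := (inferInstance : Nonempty (K →+* ℂ))
  refine ⟨HeckeCharacter.embExponent p q φ₀, fun φ => ?_⟩
  have hφ := hwt φ
  have hφ₀ := hwt φ₀
  rw [ComplexEmbedding.isReal_iff.mp (IsTotallyReal.complexEmbedding_isReal φ)] at hφ
  rw [ComplexEmbedding.isReal_iff.mp (IsTotallyReal.complexEmbedding_isReal φ₀)] at hφ₀
  omega

/-! ### §4 The repaired `n = 1` conjunct: what is left of HT₁, and the totally real case -/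

/-- ★ **Granting dR₁ and FM₁, the R3⁺-repaired `n = 1` conjunct over `K` ⟺ HT₁ for the NON-parallel
Hecke characters only** (Λ23 `globalLanglandsCorrespondenceGLnR3plus_one_iff_ht_of_facts` with the
parallel case discharged by §2).  Non-parallel algebraic types exist iff `K` contains a CM field.
[cite: BuzzardGeeLMS2014, Conj. 3.2.1–3.2.2 and Rem. 3.2.3] [cite: Weil1956, §1]
[cite: SerreAbelianLadic1968, Ch. III §1.1, §2.3 and App. A] [cite: Patrikis2019, Prop. 2.2.1] -/
theorem globalLanglandsCorrespondenceGLnR3plus_one_iff_ht_nonparallel_of_facts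
    (hDR : HeckeCharacter.exists_lAdic_isDeRhamFramed)
    (hFM : FramedGaloisRep.exists_heckeCharacter_of_isDeRhamFramed) (𝓡 : ReciprocityData K) :
    R3plus.GlobalLanglandsCorrespondenceGLnR3plus 1 K 𝓡 hcpt ↔
      ∀ (π : CuspidalAutomorphicRepData 1 K hcpt) (θ : HeckeCharacter K),
        (∀ (g : (AdelicGroupData.gl 1 K).Adelic), ∀ φ ∈ π.1.W,
          rightTranslation (AdelicGroupData.gl 1 K) g φ -
            ((θ (Matrix.GeneralLinearGroup.det g) : ℂˣ) : ℂ) • φ ∈ π.1.W') →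
        ∀ (p q : InfinitePlace K → ℤ) (hinf : θ.HasInfinityType p q),
          (¬ ∃ n₀ : ℤ, ∀ φ : K →+* ℂ, HeckeCharacter.embExponent p q φ = n₀) →
          ∀ (T : Finset (HeightOneSpectrum (𝓞 K))) (e : HeightOneSpectrum (𝓞 K) → ℕ)
            (hmod : HeckeCharacter.IsModulus θ T e) (ℓ : ℕ) [Fact ℓ.Prime] (ι : PadicAlgCl ℓ ≃+* ℂ)
            (v : HeightOneSpectrum (𝓞 K)) (hv : ((ℓ : ℕ) : 𝓞 K) ∈ v.asIdeal),
            R3plus.HodgeTateCompatibleAt 𝓡 ι π.1 (hinf.weilRep hmod ι) v hv := by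
  rw [globalLanglandsCorrespondenceGLnR3plus_one_iff_ht_of_facts hDR hFM 𝓡]
  refine ⟨fun h π θ hχ p q hinf _ T e hmod ℓ _ ι v hv => h π θ hχ p q hinf T e hmod ℓ ι v hv,
    fun h π θ hχ p q hinf T e hmod ℓ _ ι v hv => ?_⟩
  by_cases hpar : ∃ n₀ : ℤ, ∀ φ : K →+* ℂ, HeckeCharacter.embExponent p q φ = n₀
  · obtain ⟨n₀, hn⟩ := hpar
    exact hodgeTateCompatibleAt_weilRep_of_embExponent_eq 𝓡 ι π.1 hχ hinf hmod hn v hv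
  · exact h π θ hχ p q hinf hpar T e hmod ℓ ι v hv

/-- ★★ **Over a totally real field, clause (A⁺)₁ holds granting dR₁ alone** (`r_{θ,ι}` de Rham above
`ℓ`, Serre III §2.3 + App. A / Conrad App. B.4): the Hodge–Tate third is §2 + §3.
[cite: BuzzardGeeLMS2014, Conj. 3.2.1–3.2.2 and Rem. 3.2.3] [cite: SerreAbelianLadic1968, Ch. III §2.3 and App. A]
[cite: Conrad2011LiftingGlobal, App. B, Prop. B.4] -/
theorem automorphicToGaloisR3plus_one_of_fact_of_isTotallyReal [IsTotallyReal K]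
    (hDR : HeckeCharacter.exists_lAdic_isDeRhamFramed) (𝓡 : ReciprocityData K) :
    R3plus.AutomorphicToGaloisR3plus 1 𝓡 hcpt :=
  (automorphicToGaloisR3plus_one_iff_weilRep 𝓡).mpr fun π θ hχ p q hinf T e hmod ℓ _ ι => by
    obtain ⟨n₀, hn⟩ := exists_embExponent_eq_of_isTotallyReal hinf
    exact ⟨fun v hv => isDeRhamFramed_weilRep_of_fact hDR 𝓡 ι hinf hmod v hv,
      fun v hv => hodgeTateCompatibleAt_weilRep_of_embExponent_eq 𝓡 ι π.1 hχ hinf hmod hn v hv⟩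

/-- ★★★ **Over a totally real field the R3⁺-repaired summit HOLDS for `n = 1` granting dR₁ and FM₁** —
two theorems in print about constructed objects (Serre III §2.3 + App. A / Conrad App. B.4; Patrikis
Prop. 2.2.1) — for every reciprocity datum `𝓡`.  Λ23
`globalLanglandsCorrespondenceGLnR3plus_one_of_facts` needed the Hodge–Tate third HT₁ as well; over a
totally real `K` it is §2 + §3. [cite: BuzzardGeeLMS2014, Conj. 3.2.1–3.2.2, Rem. 3.2.3 and Rem. 3.2.5]
[cite: SerreAbelianLadic1968, Ch. III §1.1, §2.3 and App. A] [cite: Patrikis2019, Prop. 2.2.1]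
[cite: Conrad2011LiftingGlobal, App. B, Prop. B.4] -/
theorem globalLanglandsCorrespondenceGLnR3plus_one_of_facts_of_isTotallyReal [IsTotallyReal K]
    (hDR : HeckeCharacter.exists_lAdic_isDeRhamFramed)
    (hFM : FramedGaloisRep.exists_heckeCharacter_of_isDeRhamFramed) (𝓡 : ReciprocityData K) :
    R3plus.GlobalLanglandsCorrespondenceGLnR3plus 1 K 𝓡 hcpt :=
  (globalLanglandsCorrespondenceGLnR3plus_one_iff_ht_nonparallel_of_facts hDR hFM 𝓡).mpr
    fun _ _ _ _ _ hinf hpar => absurd (exists_embExponent_eq_of_isTotallyReal hinf) hpar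

end HodgeTateParallel

end GLOneRigidity

end Summit.Langlands.Langlands.Theorems
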